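import Literature.Barriers.RiemannHypothesis.EpsteinZetaRealZerosDHPhase
import Mathlib.Analysis.SpecialFunctions.Complex.Arg
import Mathlib.Analysis.Real.Pi.Bounds
import HarnessLib

/-!
# Davenport–Heilbronn for Epstein zeta functions, XII: the two-parameter zero — a real zero of the
# steered function from a monotone phase equation and a diverging argument

Sibling of `Literature/Barriers/RiemannHypothesis/EpsteinZetaRealZeros.lean` (named fact
`DavenportHeilbronn1936b_epstein`). Everything in this file is PROVED; no definitions, no named
facts; no number fields — pure real/complex analysis.

Davenport–Heilbronn II, §5, Lemma 2: "For any given `δ > 0` there is a set of numbers `a(p)` with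
`|a(p)| = 1` such that `F_a(s)` has a zero in `1 < s < 1 + δ`." D–H solve the equations
`∏_p {1 − a(p)p^{-s}}^{-2} = −2N ℜχ_ν(𝔎) ∏_p {…}⁻¹` for the `a(p)` by induction, which needs the
prime number theorem for ideal classes ((4): `p_n ∼ (h/N) n log n`). The tree proves Lemma 2 by a
variant needing only Dirichlet densities: after the finitely many moduli have been steered
(`EpsteinZetaRealZerosDHOdd.lean`), the normalised function takes the form

  `G(s, φ) = exp(i D(s) + q(s) + λ_ℂ(φ, x_s)) + 1 + ρ(s, φ)`,

where `D(s) → +∞` as `s → 1⁺` (the degree-one prime sum `Σ N𝔭^{-s}`, from the principal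
character), `q` is continuous and bounded, `x_s = p₁^{-s} ≤ 1/40` for the one prime `p₁` carrying
the free phase `a(p₁) = e^{iφ}`, `λ_ℂ(φ, x) = 2ℓ(x e^{iφ}) − ℓ(u x e^{iφ}) − ℓ(u⁻¹ x e^{iφ})`
(`ℓ(z) = −log(1 − z)`, `u = χ*(𝔭₁)`, `ℜu ≤ 0`), and `ρ` (the other characters) is small. This file
proves the abstract statement `exists_zero_phase_family`: if moreover the *centering condition*
`|ℜq(s) + ½(λ(π/6, x_s) + λ(5π/6, x_s))| ≤ x_s/4` holds, then `G(s, φ) = 0` for some real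
`s ∈ (1, s₁]` and `φ ∈ [π/6, 5π/6]`, and `G(s', φ) ≠ 0` for some other `s'`. Mechanism: the modulus
equation `R(s, φ) = ℜq + λ(φ, x_s) − log|1 + ρ| = 0` has, for each `s`, a unique solution `φ(s)`
(`λ` decreases at rate `x_s/2`, `phaseGap_sub_le`; `ρ` is `x_s²`-Lipschitz), continuous in `s`
(`exists_continuousOn_zero_of_strictAntiOn`); along it the argument
`Θ = D + ℑq + ℑλ_ℂ − arg(1 + ρ)` is continuous and tends to `+∞` as `s → 1⁺`, so it passes an odd
multiple of `π`, where `exp(iD + q + λ_ℂ) = −(1 + ρ)`. The local logarithm enters as a parameter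
`ℓ` with its defining equation `hℓ` (to keep the statement small).

## References

* [DavenportHeilbronn1936b] H. Davenport, H. Heilbronn, *On the zeros of certain Dirichlet
  series II*, J. London Math. Soc. 11 (1936), 307–312, §5 Lemma 2.
-/

noncomputable section

open Complex Filter Topology Set

namespace Literature.Barriers.RiemannHypothesis

namespace DHEpstein

/-! ## Small facts -/

/-- `|log|1 + z|| ≤ 2|z|` for `|z| ≤ 1/2`. [folklore] -/
theorem abs_log_norm_one_add_le {z : ℂ} (hz : ‖z‖ ≤ 1 / 2) : |Real.log ‖1 + z‖| ≤ 2 * ‖z‖ := by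
  have h := abs_log_norm_add_sub_le (W := 1) (ρ₁ := 0) (ρ₂ := z) one_ne_zero (by simp)
    (by rwa [norm_one])
  simpa using h

/-- `exp w = −1` forces `ℑw = (2m + 1)π` for some integer `m`. [folklore] -/
theorem im_eq_of_cexp_eq_neg_one {w : ℂ} (h : cexp w = -1) : ∃ m : ℤ, w.im = (2 * m + 1) * Real.pi := by
  have h1 : cexp (w - Real.pi * I) = 1 := by
    rw [Complex.exp_sub, h, Complex.exp_pi_mul_I, neg_div_neg_eq, div_one]
  obtain ⟨m, hm⟩ := Complex.exp_eq_one_iff.1 h1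
  refine ⟨m, ?_⟩
  have := congrArg Complex.im hm
  simp only [sub_im, mul_im, ofReal_re, ofReal_im, I_re, I_im, mul_zero, mul_one, zero_add,
    intCast_re, intCast_im, mul_re, zero_mul, sub_zero, re_ofNat, im_ofNat] at this
  linarith

/-- `exp((2n+1)π i) = −1`. [folklore] -/
theorem cexp_odd_mul_pi_mul_I (n : ℤ) : cexp (((2 * n + 1) * Real.pi : ℝ) * I) = -1 := by
  have e : (((2 * n + 1) * Real.pi : ℝ) : ℂ) * I = n * (2 * Real.pi * I) + Real.pi * I := by
    push_cast; ring
  rw [e, Complex.exp_add, Complex.exp_int_mul_two_pi_mul_I, one_mul, Complex.exp_pi_mul_I]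

/-- If `ℜE = log|z|` and `ℑE = (2n+1)π + arg z` (`z ≠ 0`) then `exp E = −z`. [folklore] -/
theorem cexp_eq_neg_of_re_im {E z : ℂ} (hz : z ≠ 0) {n : ℤ} (hre : E.re = Real.log ‖z‖)
    (him : E.im = (2 * n + 1) * Real.pi + arg z) : cexp E = -z := by
  have hE : E = (((2 * n + 1) * Real.pi : ℝ) : ℂ) * I + Complex.log z := by
    apply Complex.ext
    · simp only [add_re, mul_re, ofReal_re, ofReal_im, I_re, I_im, mul_zero, zero_mul, sub_zero,
        Complex.log_re, zero_add]
      exact hre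
    · simp only [add_im, mul_im, ofReal_re, ofReal_im, I_re, I_im, mul_one, zero_mul, add_zero,
        Complex.log_im]
      exact him
  rw [hE, Complex.exp_add, Complex.exp_log hz, cexp_odd_mul_pi_mul_I]
  ring

/-- If `exp E = −z` (`z ≠ 0`) then `ℑE − arg z` is an odd multiple of `π`. [folklore] -/
theorem exists_im_sub_arg_eq_of_cexp_eq_neg {E z : ℂ} (hz : z ≠ 0) (h : cexp E = -z) :
    ∃ m : ℤ, E.im - arg z = (2 * m + 1) * Real.pi := by
  have h2 : cexp (E - Complex.log z) = -1 := by
    rw [Complex.exp_sub, Complex.exp_log hz, h, neg_div, div_self hz]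
  obtain ⟨m, hm⟩ := im_eq_of_cexp_eq_neg_one h2
  refine ⟨m, ?_⟩
  rwa [sub_im, Complex.log_im] at hm

/-- `(2n+1)π + 1` is not an odd multiple of `π`. [folklore] -/
theorem odd_mul_pi_add_one_ne (n m : ℤ) : (2 * n + 1) * Real.pi + 1 ≠ (2 * m + 1) * Real.pi := by
  intro h
  have hk : (1 : ℝ) = 2 * (m - n) * Real.pi := by linarith
  have hpi := Real.pi_gt_three
  rcases lt_trichotomy m n with hmn | rfl | hmn
  · have : (m : ℝ) - n ≤ -1 := by exact_mod_cast (show m - n ≤ -1 by omega)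
    nlinarith
  · simp at hk
  · have : (1 : ℝ) ≤ m - n := by exact_mod_cast (show 1 ≤ m - n by omega)
    nlinarith

/-- The local logarithm `(x, φ) ↦ −log(1 − a x e^{iφ})` is jointly continuous on `0 ≤ x ≤ 1/2`
(`|a| = 1`). [folklore] -/
theorem continuousOn_locLog_two {a : ℂ} (ha : ‖a‖ = 1) :
    ContinuousOn (fun q : ℝ × ℝ ↦ -Complex.log (1 - a * q.1 * cexp (q.2 * I))) (Icc 0 (1 / 2) ×ˢ univ) := by
  have hcont : Continuous fun q : ℝ × ℝ ↦ 1 - a * q.1 * cexp (q.2 * I) := by fun_prop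
  refine (hcont.continuousOn.clog fun q hq ↦ ?_).neg
  obtain ⟨⟨h0, h1⟩, -⟩ := hq
  exact one_sub_mem_slitPlane_of_norm_le_half (by rw [norm_mul_mul_cexp ha h0]; exact h1)

/-! ## The abstract two-parameter zero -/

/-- **The steered function has a real zero** (the analytic core of the tree's proof of D–H II,
Lemma 2). Let `ℓ(c, x, φ) = −log(1 − c x e^{iφ})` (a parameter with its defining equation),
`1 < s₁`, `S = (1, s₁]`, `J = [π/6, 5π/6]`; `D : ℝ → ℝ` continuous on `S` with `D → +∞` at `1⁺`;
`q : ℝ → ℂ` continuous and bounded on `S`; `x : ℝ → ℝ` continuous on `S` with `0 < x_s ≤ 1/40`;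
`u` of modulus `1` with `ℜu ≤ 0`; finitely many unit `α_i` and coefficients `k_i` continuous on `S`
with `Σ_i |k_i(s)| ≤ x_s/200`; and the centering condition
`|ℜq(s) + ½(λ(π/6, x_s) + λ(5π/6, x_s))| ≤ x_s/4`, `λ(φ, x) = 2ℜℓ(1,x,φ) − ℜℓ(u,x,φ) − ℜℓ(u⁻¹,x,φ)`.
Then there are `s ∈ S`, `φ ∈ J` with
`exp(iD(s) + q(s) + 2ℓ(1,x_s,φ) − ℓ(u,x_s,φ) − ℓ(u⁻¹,x_s,φ)) + 1 +
 Σ_i k_i(s) exp(ℓ(α_i,x_s,φ) + ℓ(α_i⁻¹,x_s,φ) − ℓ(u,x_s,φ) − ℓ(u⁻¹,x_s,φ)) = 0`,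
and `s' ∈ S` at which the same expression (same `φ`) is `≠ 0`.
[cite: DavenportHeilbronn1936b, §5 Lemma 2] -/
theorem exists_zero_phase_family (ℓ : ℂ → ℝ → ℝ → ℂ)
    (hℓ : ∀ (c : ℂ) (x φ : ℝ), ℓ c x φ = -Complex.log (1 - c * x * cexp (φ * I)))
    {s₁ : ℝ} (hs₁ : 1 < s₁) (D : ℝ → ℝ) (q : ℝ → ℂ) (xs : ℝ → ℝ)
    (u : ℂ) (hu : ‖u‖ = 1) (hure : u.re ≤ 0) {ι : Type*} (O : Finset ι) (k : ι → ℝ → ℂ) (α : ι → ℂ)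
    (hα : ∀ i ∈ O, ‖α i‖ = 1)
    (hD : ContinuousOn D (Ioc 1 s₁)) (hDlim : Tendsto D (𝓝[>] 1) atTop)
    (hq : ContinuousOn q (Ioc 1 s₁)) {Mq : ℝ} (hqb : ∀ s ∈ Ioc 1 s₁, ‖q s‖ ≤ Mq)
    (hxs : ContinuousOn xs (Ioc 1 s₁)) (hx : ∀ s ∈ Ioc 1 s₁, 0 < xs s ∧ xs s ≤ 1 / 40)
    (hk : ∀ i ∈ O, ContinuousOn (k i) (Ioc 1 s₁))
    (hsmall : ∀ s ∈ Ioc 1 s₁, ∑ i ∈ O, ‖k i s‖ ≤ xs s / 200)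
    (hcenter : ∀ s ∈ Ioc 1 s₁, |(q s).re +
      ((2 * (ℓ 1 (xs s) (Real.pi / 6)).re - (ℓ u (xs s) (Real.pi / 6)).re - (ℓ u⁻¹ (xs s) (Real.pi / 6)).re) +
        (2 * (ℓ 1 (xs s) (5 * Real.pi / 6)).re - (ℓ u (xs s) (5 * Real.pi / 6)).re -
          (ℓ u⁻¹ (xs s) (5 * Real.pi / 6)).re)) / 2| ≤ xs s / 4) :
    ∃ s ∈ Ioc 1 s₁, ∃ φ ∈ Icc (Real.pi / 6) (5 * Real.pi / 6),
      cexp (I * D s + q s + (2 * ℓ 1 (xs s) φ - ℓ u (xs s) φ - ℓ u⁻¹ (xs s) φ)) + 1 +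
        ∑ i ∈ O, k i s * cexp (ℓ (α i) (xs s) φ + ℓ (α i)⁻¹ (xs s) φ - ℓ u (xs s) φ - ℓ u⁻¹ (xs s) φ) = 0 ∧
      ∃ s' ∈ Ioc 1 s₁,
        cexp (I * D s' + q s' + (2 * ℓ 1 (xs s') φ - ℓ u (xs s') φ - ℓ u⁻¹ (xs s') φ)) + 1 +
          ∑ i ∈ O, k i s' * cexp (ℓ (α i) (xs s') φ + ℓ (α i)⁻¹ (xs s') φ - ℓ u (xs s') φ -
            ℓ u⁻¹ (xs s') φ) ≠ 0 := by
  -- ### notation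
  set S : Set ℝ := Ioc 1 s₁ with hS
  set a : ℝ := Real.pi / 6 with ha_def
  set b : ℝ := 5 * Real.pi / 6 with hb_def
  have hab : a < b := by rw [ha_def, hb_def]; linarith [Real.pi_pos]
  set lamC : ℝ → ℝ → ℂ := fun x φ ↦ 2 * ℓ 1 x φ - ℓ u x φ - ℓ u⁻¹ x φ with hlamC
  set lam : ℝ → ℝ → ℝ := fun x φ ↦ 2 * (ℓ 1 x φ).re - (ℓ u x φ).re - (ℓ u⁻¹ x φ).re with hlam
  have hlam_re : ∀ x φ, (lamC x φ).re = lam x φ := fun x φ ↦ by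
    simp only [hlamC, hlam, sub_re, mul_re, Complex.re_ofNat, Complex.im_ofNat, zero_mul, sub_zero]
  set Lf : ι → ℝ → ℝ → ℂ := fun i x φ ↦ ℓ (α i) x φ + ℓ (α i)⁻¹ x φ - ℓ u x φ - ℓ u⁻¹ x φ with hLf
  set ρ : ℝ → ℝ → ℂ := fun s φ ↦ ∑ i ∈ O, k i s * cexp (Lf i (xs s) φ) with hρ
  set G : ℝ → ℝ → ℂ := fun s φ ↦ cexp (I * D s + q s + lamC (xs s) φ) + 1 + ρ s φ with hG
  set R : ℝ → ℝ → ℝ := fun s φ ↦ (q s).re + lam (xs s) φ - Real.log ‖1 + ρ s φ‖ with hR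
  set Θ : ℝ → ℝ → ℝ := fun s φ ↦ D s + (q s).im + (lamC (xs s) φ).im - arg (1 + ρ s φ) with hΘ
  change ∃ s ∈ S, ∃ φ ∈ Icc a b, G s φ = 0 ∧ ∃ s' ∈ S, G s' φ ≠ 0
  -- ### unit moduli
  have hu' : ‖u⁻¹‖ = 1 := by rw [norm_inv, hu, inv_one]
  have h1' : ‖(1 : ℂ)‖ = 1 := norm_one
  have hα' : ∀ i ∈ O, ‖(α i)⁻¹‖ = 1 := fun i hi ↦ by rw [norm_inv, hα i hi, inv_one]
  -- ### size of the local logarithms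
  have hx2 : ∀ s ∈ S, xs s ≤ 1 / 2 := fun s hs ↦ by linarith [(hx s hs).2]
  have hℓsz : ∀ {c : ℂ}, ‖c‖ = 1 → ∀ s ∈ S, ∀ φ : ℝ, ‖ℓ c (xs s) φ‖ ≤ 3 / 2 * xs s := by
    intro c hc s hs φ
    have h := norm_neg_log_one_sub_le (z := c * xs s * cexp (φ * I))
      (by rw [norm_mul_mul_cexp hc (hx s hs).1.le]; exact hx2 s hs)
    rwa [norm_mul_mul_cexp hc (hx s hs).1.le, ← hℓ] at h
  have hlamC_norm : ∀ s ∈ S, ∀ φ : ℝ, ‖lamC (xs s) φ‖ ≤ 1 := by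
    intro s hs φ
    have hxs := (hx s hs).2
    have e : lamC (xs s) φ = ℓ 1 (xs s) φ + ℓ 1 (xs s) φ - ℓ u (xs s) φ - ℓ u⁻¹ (xs s) φ := by
      simp only [hlamC]; ring
    rw [e]
    calc ‖ℓ 1 (xs s) φ + ℓ 1 (xs s) φ - ℓ u (xs s) φ - ℓ u⁻¹ (xs s) φ‖
        ≤ ‖ℓ 1 (xs s) φ‖ + ‖ℓ 1 (xs s) φ‖ + ‖ℓ u (xs s) φ‖ + ‖ℓ u⁻¹ (xs s) φ‖ :=
          (norm_sub_le _ _).trans (add_le_add ((norm_sub_le _ _).trans (add_le_add (norm_add_le _ _) le_rfl)) le_rfl)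
      _ ≤ 3 / 2 * xs s + 3 / 2 * xs s + 3 / 2 * xs s + 3 / 2 * xs s :=
          add_le_add (add_le_add (add_le_add (hℓsz h1' s hs φ) (hℓsz h1' s hs φ)) (hℓsz hu s hs φ)) (hℓsz hu' s hs φ)
      _ ≤ 1 := by linarith
  -- ### the remainder `ρ`: bound and Lipschitz bound
  have hρ_bd : ∀ s ∈ S, (∀ φ : ℝ, ‖ρ s φ‖ ≤ 3 * (xs s / 200)) ∧
      ∀ φ₁ φ₂ : ℝ, ‖ρ s φ₂ - ρ s φ₁‖ ≤ 24 * xs s * (xs s / 200) * |φ₂ - φ₁| := by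
    intro s hs
    have h := norm_sub_le_of_locExp O (fun i ↦ k i s) α (fun i ↦ (α i)⁻¹) u u⁻¹ hα hα' hu hu'
      (hx s hs).1.le (hx s hs).2
    simp only [← hℓ] at h
    obtain ⟨hb, hl⟩ := h
    constructor
    · intro φ
      exact (hb φ).trans (by have := hsmall s hs; nlinarith)
    · intro φ₁ φ₂
      refine (hl φ₁ φ₂).trans ?_
      have := hsmall s hs
      have h0 : 0 ≤ 24 * xs s := by linarith [(hx s hs).1]
      have h1 : 0 ≤ |φ₂ - φ₁| := abs_nonneg _
      gcongr
  have hρ_half : ∀ s ∈ S, ∀ φ : ℝ, ‖ρ s φ‖ ≤ 1 / 2 := fun s hs φ ↦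
    ((hρ_bd s hs).1 φ).trans (by linarith [(hx s hs).2])
  have hone_ρ_slit : ∀ s ∈ S, ∀ φ : ℝ, 1 + ρ s φ ∈ slitPlane := fun s hs φ ↦
    mem_slitPlane_of_norm_lt_one (by linarith [hρ_half s hs φ])
  have hone_ρ_ne : ∀ s ∈ S, ∀ φ : ℝ, 1 + ρ s φ ≠ 0 := fun s hs φ ↦
    slitPlane_ne_zero (hone_ρ_slit s hs φ)
  have hlog_ρ : ∀ s ∈ S, ∀ φ : ℝ, |Real.log ‖1 + ρ s φ‖| ≤ 3 * xs s / 100 := fun s hs φ ↦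
    (abs_log_norm_one_add_le (hρ_half s hs φ)).trans (by linarith [(hρ_bd s hs).1 φ])
  -- ### the phase gap in this notation
  have hgap : ∀ s ∈ S, ∀ φ₁ φ₂ : ℝ, a ≤ φ₁ → φ₁ ≤ φ₂ → φ₂ ≤ b →
      lam (xs s) φ₂ - lam (xs s) φ₁ ≤ -(xs s / 2) * (φ₂ - φ₁) := by
    intro s hs φ₁ φ₂ h1 h12 h2
    have h := phaseGap_sub_le hu hure (hx s hs).1 (hx s hs).2 h1 h12 h2
    simp only [← hℓ] at h
    simp only [hlam]
    exact h
  -- ### strict decrease of `R(s, ·)` on `J`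
  have hanti : ∀ s ∈ S, StrictAntiOn (R s) (Icc a b) := by
    intro s hs φ₁ hφ₁ φ₂ hφ₂ hlt
    have hxs := hx s hs
    have hg := hgap s hs φ₁ φ₂ hφ₁.1 hlt.le hφ₂.2
    have hlip : |Real.log ‖1 + ρ s φ₂‖ - Real.log ‖1 + ρ s φ₁‖| ≤ 2 * ‖ρ s φ₂ - ρ s φ₁‖ / ‖(1 : ℂ)‖ :=
      abs_log_norm_add_sub_le one_ne_zero (by rw [norm_one]; exact hρ_half s hs φ₁)
        (by rw [norm_one]; exact hρ_half s hs φ₂)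
    rw [norm_one, div_one] at hlip
    have hlip' := (hρ_bd s hs).2 φ₁ φ₂
    rw [abs_of_pos (sub_pos.2 hlt)] at hlip'
    have hsmallsq : 24 * xs s * (xs s / 200) ≤ xs s / 8 := by nlinarith
    show R s φ₂ < R s φ₁
    simp only [hR]
    have := (abs_le.1 hlip).1
    nlinarith [sub_pos.2 hlt]
  -- ### sign conditions
  have hpi3 : (1 : ℝ) < Real.pi / 3 := by linarith [Real.pi_gt_three]
  have hsign : ∀ s ∈ S, 0 < R s a ∧ R s b < 0 := by
    intro s hs
    have hxs := hx s hs
    have hg := hgap s hs a b le_rfl hab.le le_rfl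
    have hc := hcenter s hs
    change |(q s).re + (lam (xs s) a + lam (xs s) b) / 2| ≤ xs s / 4 at hc
    have hla := hlog_ρ s hs a
    have hlb := hlog_ρ s hs b
    have hba : b - a = 2 * Real.pi / 3 := by rw [ha_def, hb_def]; ring
    rw [hba] at hg
    rw [abs_le] at hc hla hlb
    simp only [hR]
    constructor <;> nlinarith
  -- ### joint continuity
  have hmapsx : ∀ p ∈ S ×ˢ Icc a b, ((xs p.1, p.2) : ℝ × ℝ) ∈ Icc (0 : ℝ) (1 / 2) ×ˢ (univ : Set ℝ) := by
    rintro ⟨s, φ⟩ ⟨hs, -⟩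
    exact ⟨⟨(hx s hs).1.le, hx2 s hs⟩, mem_univ _⟩
  have hxs2 : ContinuousOn (fun p : ℝ × ℝ ↦ ((xs p.1, p.2) : ℝ × ℝ)) (S ×ˢ Icc a b) :=
    ((hxs.comp continuousOn_fst fun p hp ↦ hp.1).prodMk continuousOn_snd)
  have hℓcont : ∀ {c : ℂ}, ‖c‖ = 1 → ContinuousOn (fun p : ℝ × ℝ ↦ ℓ c (xs p.1) p.2) (S ×ˢ Icc a b) := by
    intro c hc
    have h := (continuousOn_locLog_two hc).comp hxs2 hmapsx
    refine h.congr fun p _ ↦ ?_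
    simp only [Function.comp_apply, hℓ]
  have hqcont : ContinuousOn (fun p : ℝ × ℝ ↦ q p.1) (S ×ˢ Icc a b) := hq.comp continuousOn_fst fun p hp ↦ hp.1
  have hDcont : ContinuousOn (fun p : ℝ × ℝ ↦ D p.1) (S ×ˢ Icc a b) := hD.comp continuousOn_fst fun p hp ↦ hp.1
  have hlamCcont : ContinuousOn (fun p : ℝ × ℝ ↦ lamC (xs p.1) p.2) (S ×ˢ Icc a b) :=
    ((continuousOn_const.mul (hℓcont h1')).sub (hℓcont hu)).sub (hℓcont hu')
  have hlamcont : ContinuousOn (fun p : ℝ × ℝ ↦ lam (xs p.1) p.2) (S ×ˢ Icc a b) := by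
    have := Complex.continuous_re.comp_continuousOn hlamCcont
    refine this.congr fun p _ ↦ ?_
    simp only [Function.comp_apply, hlam_re]
  have hρcont : ContinuousOn (fun p : ℝ × ℝ ↦ ρ p.1 p.2) (S ×ˢ Icc a b) := by
    refine continuousOn_finsetSum _ fun i hi ↦ ?_
    exact ((hk i hi).comp continuousOn_fst fun p hp ↦ hp.1).mul
      ((((hℓcont (hα i hi)).add (hℓcont (hα' i hi))).sub (hℓcont hu)).sub (hℓcont hu')).cexp
  have hRcont : ContinuousOn (fun p : ℝ × ℝ ↦ R p.1 p.2) (S ×ˢ Icc a b) := by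
    refine ((Complex.continuous_re.comp_continuousOn hqcont).add hlamcont).sub ?_
    exact ((continuousOn_const.add hρcont).norm).log fun p hp ↦
      (norm_pos_iff.2 (hone_ρ_ne p.1 hp.1 p.2)).ne'
  have hΘcont : ContinuousOn (fun p : ℝ × ℝ ↦ Θ p.1 p.2) (S ×ˢ Icc a b) := by
    refine ((hDcont.add (Complex.continuous_im.comp_continuousOn hqcont)).add
      (Complex.continuous_im.comp_continuousOn hlamCcont)).sub ?_
    intro p hp
    exact ContinuousAt.comp_continuousWithinAt (g := arg) (f := fun p : ℝ × ℝ ↦ 1 + ρ p.1 p.2)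
      (continuousAt_arg (hone_ρ_slit p.1 hp.1 p.2)) ((continuousOn_const.add hρcont) p hp)
  -- ### the continuous zero `φ(s)` of `R(s, ·)`
  obtain ⟨g, hgcont, hg⟩ := exists_continuousOn_zero_of_strictAntiOn hab.le hRcont hanti
    (fun s hs ↦ (hsign s hs).1) (fun s hs ↦ (hsign s hs).2)
  have hgmem : ∀ s ∈ S, g s ∈ Icc a b := fun s hs ↦ Ioo_subset_Icc_self (hg s hs).1
  -- `Θ` along the curve, and along a horizontal line
  have hΘg : ContinuousOn (fun s ↦ Θ s (g s)) S :=
    hΘcont.comp (f := fun s ↦ (s, g s)) (continuousOn_id.prodMk hgcont) fun s hs ↦ ⟨hs, hgmem s hs⟩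
  have hΘφ : ∀ φ ∈ Icc a b, ContinuousOn (fun s ↦ Θ s φ) S := fun φ hφ ↦
    hΘcont.comp (f := fun s ↦ (s, φ)) (continuousOn_id.prodMk continuousOn_const) fun s hs ↦ ⟨hs, hφ⟩
  -- ### bounds on `Θ - D`
  have hΘbd : ∀ s ∈ S, ∀ φ : ℝ, |Θ s φ - D s| ≤ Mq + 1 + Real.pi := by
    intro s hs φ
    have h1 : |(q s).im| ≤ Mq := (abs_im_le_norm _).trans (hqb s hs)
    have h2 : |(lamC (xs s) φ).im| ≤ 1 := (abs_im_le_norm _).trans (hlamC_norm s hs φ)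
    have h3 : |arg (1 + ρ s φ)| ≤ Real.pi := abs_arg_le_pi _
    have e : Θ s φ - D s = (q s).im + (lamC (xs s) φ).im - arg (1 + ρ s φ) := by
      simp only [hΘ]; ring
    rw [e]
    rw [abs_le] at h1 h2 h3 ⊢
    constructor <;> linarith
  -- ### the target odd multiple of `π`
  have hs₁S : s₁ ∈ S := ⟨hs₁, le_rfl⟩
  obtain ⟨n, hn⟩ := exists_int_gt ((Θ s₁ (g s₁)) / (2 * Real.pi))
  set τ : ℝ := (2 * n + 1) * Real.pi with hτ
  have hτgt : Θ s₁ (g s₁) < τ := by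
    rw [hτ]
    have h2π : 0 < 2 * Real.pi := by linarith [Real.pi_pos]
    rw [div_lt_iff₀ h2π] at hn
    nlinarith [Real.pi_pos]
  -- near `1⁺`, `Θ` exceeds `τ + 2`
  have hev : ∀ᶠ s in 𝓝[>] (1 : ℝ), τ + 2 + (Mq + 1 + Real.pi) < D s ∧ s ∈ S :=
    (hDlim.eventually_gt_atTop _).and (Ioc_mem_nhdsGT hs₁)
  obtain ⟨s₀, hD₀, hs₀S⟩ := hev.exists
  have hΘ₀ : ∀ φ : ℝ, τ + 2 < Θ s₀ φ := fun φ ↦ by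
    have := (abs_le.1 (hΘbd s₀ hs₀S φ)).1
    linarith
  have hs₀₁ : s₀ ≤ s₁ := hs₀S.2
  have hIcc : Icc s₀ s₁ ⊆ S := fun s hs ↦ ⟨lt_of_lt_of_le hs₀S.1 hs.1, hs.2⟩
  -- ### IVT along the curve: `Θ(s*, φ(s*)) = τ`
  obtain ⟨sz, hsz, hΘsz⟩ : ∃ sz ∈ Icc s₀ s₁, Θ sz (g sz) = τ := by
    have h := intermediate_value_Icc' hs₀₁ (hΘg.mono hIcc)
    exact h ⟨hτgt.le, by linarith [hΘ₀ (g s₀)]⟩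
  have hszS : sz ∈ S := hIcc hsz
  set φz := g sz with hφz
  have hφzJ : φz ∈ Icc a b := hgmem sz hszS
  have hRz : R sz φz = 0 := (hg sz hszS).2
  -- ### the zero
  have hzero : G sz φz = 0 := by
    have hne := hone_ρ_ne sz hszS φz
    have hre : (I * D sz + q sz + lamC (xs sz) φz).re = Real.log ‖1 + ρ sz φz‖ := by
      have h0 : (q sz).re + lam (xs sz) φz - Real.log ‖1 + ρ sz φz‖ = 0 := hRz
      simp only [add_re, mul_re, I_re, I_im, ofReal_re, ofReal_im, zero_mul, mul_zero, sub_zero, hlam_re]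
      linarith
    have him : (I * D sz + q sz + lamC (xs sz) φz).im = (2 * n + 1) * Real.pi + arg (1 + ρ sz φz) := by
      have h0 : D sz + (q sz).im + (lamC (xs sz) φz).im - arg (1 + ρ sz φz) = τ := hΘsz
      simp only [add_im, mul_im, I_re, I_im, ofReal_re, ofReal_im, one_mul, mul_zero, zero_add]
      rw [hτ] at h0
      linarith
    have h := cexp_eq_neg_of_re_im hne hre him
    show cexp (I * D sz + q sz + lamC (xs sz) φz) + 1 + ρ sz φz = 0
    rw [h]; ring
  -- ### a non-zero point on the same horizontal line
  obtain ⟨s', hs', hΘs'⟩ : ∃ s' ∈ Icc s₀ sz, Θ s' φz = τ + 1 := by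
    have hcont' : ContinuousOn (fun s ↦ Θ s φz) (Icc s₀ sz) :=
      (hΘφ φz hφzJ).mono fun s hs ↦ hIcc ⟨hs.1, hs.2.trans hsz.2⟩
    have h := intermediate_value_Icc' hsz.1 hcont'
    refine h ⟨?_, ?_⟩
    · have : Θ sz φz = τ := hΘsz
      linarith
    · linarith [hΘ₀ φz]
  have hs'S : s' ∈ S := hIcc ⟨hs'.1, hs'.2.trans hsz.2⟩
  have hnonzero : G s' φz ≠ 0 := by
    intro h0
    have hne := hone_ρ_ne s' hs'S φz
    have h1 : cexp (I * D s' + q s' + lamC (xs s') φz) = -(1 + ρ s' φz) := by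
      have : cexp (I * D s' + q s' + lamC (xs s') φz) + 1 + ρ s' φz = 0 := h0
      linear_combination this
    obtain ⟨m, hm⟩ := exists_im_sub_arg_eq_of_cexp_eq_neg hne h1
    have him : (I * D s' + q s' + lamC (xs s') φz).im - arg (1 + ρ s' φz) = Θ s' φz := by
      simp only [hΘ, add_im, mul_im, I_re, I_im, ofReal_re, ofReal_im, one_mul, mul_zero, zero_add]
    rw [him, hΘs', hτ] at hm
    exact odd_mul_pi_add_one_ne n m hm
  exact ⟨sz, hszS, φz, hφzJ, hzero, s', hs'S, hnonzero⟩

end DHEpstein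

end Literature.Barriers.RiemannHypothesis
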